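import Summits.Parity.GeneralizedHardyLittlewood.Theses.ParityLeakOneFifth
import Literature.NumberTheory.Sieve.SingularSeries
import HarnessLib

/-!
# Route ParityLeakOneFifth, crux `ParityLeakSieve` (stmt-Parity-18381), skeleton `birth`:
# stub S4 `stub_windowToDensity`

If the log-weighted dyadic twin count satisfies `T(x) = Σ_{x<n≤2x, n, n+2 prime} log n ≥ c·x/log x`
for all large `x`, then `π₂(x) ≥ (c/3)·x/log²x` for all large `x`, i.e. the route decl
`TwinLowerDensity`.  Elementary: apply the hypothesis at `y = ⌊x/2⌋`, bound each `log n ≤ log x`,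
use `(y, 2y] ⊆ [0, x]`, `y ≥ x/3` and `log y ≤ log x`.
-/

namespace Summit.Parity.GeneralizedHardyLittlewood.Theorems.ParityLeakOneFifth

open Finset

/-- **Stub S4 `stub_windowToDensity`** of skeleton `birth` (crux `ParityLeakSieve`,
stmt-Parity-18381): a dyadic log-weighted lower bound `T(x) ≥ c x/log x` for the twin primes in
`(x, 2x]` gives `π₂(x) ≥ (c/3) x/log² x` eventually, hence `TwinLowerDensity`. -/
theorem stub_windowToDensity : (∃ c : ℝ, 0 < c ∧ ∃ x₀ : ℕ, ∀ x : ℕ, x₀ ≤ x → c * (x : ℝ) / Real.log (x : ℝ) ≤ ∑ n ∈ (Finset.Ioc x (2 * x)).filter (fun n : ℕ => n.Prime ∧ (n + 2).Prime), Real.log (n : ℝ)) → Summit.Parity.GeneralizedHardyLittlewood.Theses.ParityLeakOneFifth.TwinLowerDensity := by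
  rintro ⟨c, hc, x₀, hx₀⟩
  refine ⟨c / 3, by positivity, max (2 * x₀ + 2) 16, fun x hx => ?_⟩
  have hx16 : 16 ≤ x := (le_max_right _ _).trans hx
  have hxx₀ : 2 * x₀ + 2 ≤ x := (le_max_left _ _).trans hx
  set y : ℕ := x / 2 with hy
  have hy₀ : x₀ ≤ y := by omega
  have hy2 : 2 * y ≤ x := by omega
  have hy8 : 8 ≤ y := by omega
  have hT := hx₀ y hy₀
  have hxpos : (0 : ℝ) < x := by exact_mod_cast (by omega : 0 < x)
  have hypos : (0 : ℝ) < y := by exact_mod_cast (by omega : 0 < y)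
  have hlogy : 0 < Real.log (y : ℝ) := Real.log_pos (by exact_mod_cast (by omega : 1 < y))
  have hlogx : 0 < Real.log (x : ℝ) := Real.log_pos (by exact_mod_cast (by omega : 1 < x))
  have hlogyx : Real.log (y : ℝ) ≤ Real.log (x : ℝ) :=
    Real.log_le_log hypos (by exact_mod_cast (by omega : y ≤ x))
  -- each term is at most `log x`
  have hterm : ∀ n ∈ (Finset.Ioc y (2 * y)).filter (fun n : ℕ => n.Prime ∧ (n + 2).Prime),
      Real.log (n : ℝ) ≤ Real.log (x : ℝ) := by
    intro n hn
    have hn' := (Finset.mem_filter.1 hn).1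
    rw [Finset.mem_Ioc] at hn'
    exact Real.log_le_log (by exact_mod_cast (by omega : 0 < n))
      (by exact_mod_cast (by omega : n ≤ x))
  have hsum_le : ∑ n ∈ (Finset.Ioc y (2 * y)).filter (fun n : ℕ => n.Prime ∧ (n + 2).Prime),
      Real.log (n : ℝ) ≤
      (#((Finset.Ioc y (2 * y)).filter (fun n : ℕ => n.Prime ∧ (n + 2).Prime)) : ℝ) *
        Real.log (x : ℝ) := by
    have h := Finset.sum_le_card_nsmul _ _ _ hterm
    rwa [nsmul_eq_mul] at h
  -- the window count is at most `π₂(x)`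
  have hcard : #((Finset.Ioc y (2 * y)).filter (fun n : ℕ => n.Prime ∧ (n + 2).Prime)) ≤
      Literature.NumberTheory.Sieve.twinPrimeCount x := by
    unfold Literature.NumberTheory.Sieve.twinPrimeCount
    apply Finset.card_le_card
    intro n hn
    rw [Finset.mem_filter, Finset.mem_Ioc] at hn
    rw [Finset.mem_filter, Finset.mem_range]
    exact ⟨by omega, hn.2⟩
  have hcard' : (#((Finset.Ioc y (2 * y)).filter (fun n : ℕ => n.Prime ∧ (n + 2).Prime)) : ℝ) ≤
      (Literature.NumberTheory.Sieve.twinPrimeCount x : ℝ) := by exact_mod_cast hcard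
  set K : ℝ := (#((Finset.Ioc y (2 * y)).filter (fun n : ℕ => n.Prime ∧ (n + 2).Prime)) : ℝ)
    with hK
  have hK0 : 0 ≤ K := by rw [hK]; exact Nat.cast_nonneg _
  -- `c y / log x ≤ c y / log y ≤ T(y) ≤ K log x`
  have h1 : c * (y : ℝ) / Real.log (x : ℝ) ≤ c * (y : ℝ) / Real.log (y : ℝ) :=
    div_le_div_of_nonneg_left (by positivity) hlogy hlogyx
  have h2 : c * (y : ℝ) / Real.log (x : ℝ) ≤ K * Real.log (x : ℝ) := h1.trans (hT.trans hsum_le)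
  have h3 : c * (y : ℝ) / Real.log (x : ℝ) ^ 2 ≤ K := by
    rw [pow_two, ← div_div, div_le_iff₀ hlogx]
    exact h2
  -- `x/3 ≤ y`
  have hyx3 : (x : ℝ) / 3 ≤ (y : ℝ) := by
    have h : (x : ℝ) ≤ 2 * (y : ℝ) + 1 := by exact_mod_cast (by omega : x ≤ 2 * y + 1)
    have h8 : (8 : ℝ) ≤ (y : ℝ) := by exact_mod_cast hy8
    linarith
  have h4 : c / 3 * (x : ℝ) / Real.log (x : ℝ) ^ 2 ≤ c * (y : ℝ) / Real.log (x : ℝ) ^ 2 := by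
    have hl2 : 0 < Real.log (x : ℝ) ^ 2 := by positivity
    rw [div_le_div_iff_of_pos_right hl2, show c / 3 * (x : ℝ) = c * ((x : ℝ) / 3) by ring]
    exact mul_le_mul_of_nonneg_left hyx3 hc.le
  exact h4.trans (h3.trans hcard')

end Summit.Parity.GeneralizedHardyLittlewood.Theorems.ParityLeakOneFifth
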